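import Mathlib.Tactic.Linarith
import Summits.CriticalPhenomena.PercolationContinuityZ3.Theorems.PercNearOneGluingNoHeavyLowerTailSahiCTCLoopSplit
import Summits.CriticalPhenomena.PercolationContinuityZ3.Theorems.PercNearOneGluingNoHeavyLowerTailSahiCTCHarrisUpGround
import HarnessLib

/-!
# `NoHeavyLowerTail` (crux stmt-CriticalPhenomena-4575), P3 lane: the R-FORM OF THE CO-LEVEL-2 ROW IS COEFFICIENTWISE NONNEGATIVE
# for EVERY pair of up-sets — `R' = Θ₁·(Π·Y₂ − X·Z) + Π·X₁·Z₁ ∈ ℕ[s]` (every finite type)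

Support file (seat `prim-l12-p3`, gen 24; `--supports stmt-CriticalPhenomena-4575`).  Memo `run/shared/lean/prim/prim-l12/FROM-prim-l12-p3-g24-VALUE-
LEVEL-TH2K.md` §−1/§3c; memo g23 (`…-g23-LEVEL-SPLIT.md`) for the split `Ñ_{k−2} ↔ M₂ = Π·T + e₂·R'` of the (TC) row of the slot "at least two of k
open" in the open-set language, `T = e₂(Π·Y₂ − X₂Z₂) − e_{≥2}Θ₁·GF(W₂)` (depends on the all-live parts only) and
    `R' = Θ₁·(Π·Y₂ − X·Z) + Π·X₁·Z₁`,
where for up-sets `𝒳, 𝒵 ⊆ 2^α`: `X = GF(𝒳)`, `X₁ = GF(members of size ≤ 1)`, `Y₂ = GF(members of 𝒳 ∩ 𝒵 of size ≥ 2)`, `Θ₁ = 1 + e₁`, `Π = ∏(1+s_v)`.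
g23 proved `R ≥ 0` for nested and one-sided pairs (`…SahiCTCNcSplitNestedR`, `…NcSplitOneSided`).  THIS FILE: **`R' ∈ ℕ[s]` for ALL pairs of up-sets**
(`coeff_Rprime_nonneg`), so the whole co-level-2 row (coefficientwise AND at values, loops and small sets included) reduces to `T ≥ 0`, i.e. to the
ladder form `L₂` of the all-live parts (memo g24 §5.5; nested case `…SahiCTCLadderNested`).
Proof.  If `∅ ∈ 𝒳` then `𝒳 = 2^α` and `R' = 0` (likewise for `𝒵`).  Otherwise let `L` = common loops, `L_X ⊇ L` the loops of `𝒳`, `N` = vertices that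
are loops of neither; `X₁ = W_{L_X}`, `Π·Y₂ = Π·Y − Π·W_L`, and with `H = Π·Y − X·Z`:
    `R' = Θ₁·H − Π·W_L·(1 + W_N) + Π·W_{L_X∖L}·W_{L_Z∖L}`.
The loop identity of `…SahiCTCCoLevelOne`/memo g24 §3 gives `H = GF(meets L)·GF(N₀') + [relative Harris block ≥ 0]` with `∅` and every `{w}`, `w ∈ N`,
in `N₀'`, so `Θ₁·H ≥ Θ₁·GF(meets L)·(1 + W_N)`; and `Θ₁·GF(meets L) − Π·W_L = (GF(meets L) − Π_{V∖L}·W_L) + W_{V∖L}·GF(meets L) ≥ 0` because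
`(C, u) ↦ C ∪ {u}` injects `2^{V∖L} × L` into `meets L` (`coeff_compl_mul_singles_le`).
* `coeff_compl_mul_singles_le` : `Π_{V∖L}·W_L ≤ GF(meets L)` coefficientwise;  `gf_singles_union`, `singles_univ_eq`, `filter_card_le_one_eq_singles`;
* **`coeff_Rprime_nonneg`**.
Nothing is asserted about the crux.
-/

namespace Summit.CriticalPhenomena.PercolationContinuityZ3.Theorems.SahiCTCForms

open Finset MvPolynomial SahiCTCGenFun

variable {α : Type*} [DecidableEq α] [Fintype α]

/-! ### Singles bookkeeping -/

/-- `singles` is additive over disjoint unions. [this work] -/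
theorem gf_singles_union {A B : Finset α} (h : Disjoint A B) : gf (singles (A ∪ B)) = gf (singles A) + gf (singles B) := by
  rw [← gf_union]
  · congr 1; ext S; simp only [mem_singles, mem_union]
    constructor
    · rintro ⟨u, hu, rfl⟩
      rcases hu with hu | hu
      · exact Or.inl ⟨u, hu, rfl⟩
      · exact Or.inr ⟨u, hu, rfl⟩
    · rintro (⟨u, hu, rfl⟩ | ⟨u, hu, rfl⟩)
      · exact ⟨u, Or.inl hu, rfl⟩
      · exact ⟨u, Or.inr hu, rfl⟩
  · rw [disjoint_left]
    rintro S hA hB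
    obtain ⟨u, hu, rfl⟩ := mem_singles.1 hA
    obtain ⟨u', hu', he⟩ := mem_singles.1 hB
    rw [singleton_injective he] at hu
    exact disjoint_left.1 h hu hu'

/-- `e₁ = GF(singles univ)`. [this work] -/
theorem ee_one_eq_gf_singles_univ : (ee 1 : MvPolynomial α ℤ) = gf (singles (univ : Finset α)) := by
  unfold ee bySize
  congr 1; ext S
  simp only [mem_filter, mem_powerset, subset_univ, true_and, mem_singles, mem_univ, card_eq_one]

/-- For a family `𝒳 ∌ ∅`, its members of size `≤ 1` are the singletons `{u}` with `{u} ∈ 𝒳`. [this work] -/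
theorem filter_card_le_one_eq_singles {𝒳 : Finset (Finset α)} (h0 : ∅ ∉ 𝒳) :
    (𝒳.filter fun S => #S ≤ 1) = singles (univ.filter fun u => ({u} : Finset α) ∈ 𝒳) := by
  ext S
  simp only [mem_filter, mem_singles, mem_univ, true_and]
  constructor
  · rintro ⟨hS, hc⟩
    rcases Nat.lt_or_ge #S 1 with h | h
    · have : S = ∅ := card_eq_zero.1 (by omega)
      subst this; exact absurd hS h0
    · obtain ⟨u, rfl⟩ := card_eq_one.1 (le_antisymm hc h)
      exact ⟨u, hS, rfl⟩
  · rintro ⟨u, hu, rfl⟩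
    exact ⟨hu, by rw [card_singleton]⟩

omit [Fintype α] in
/-- The members of size `≥ 2` and of size `≤ 1` partition a family. [this work] -/
theorem gf_filter_two_le_eq (𝒴 : Finset (Finset α)) :
    gf (𝒴.filter fun S => 2 ≤ #S) = gf 𝒴 - gf (𝒴.filter fun S => #S ≤ 1) := by
  rw [eq_sub_iff_add_eq, add_comm, ← gf_union]
  · congr 1; ext S; simp only [mem_union, mem_filter]; constructor
    · rintro (⟨h, _⟩ | ⟨h, _⟩) <;> exact h
    · intro h; by_cases hc : #S ≤ 1
      · exact Or.inl ⟨h, hc⟩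
      · exact Or.inr ⟨h, by omega⟩
  · exact disjoint_left.2 fun S h1 h2 => by
      have := (mem_filter.1 h1).2; have := (mem_filter.1 h2).2; omega

/-! ### `Π_{V∖L}·W_L ≤ GF(meets L)` -/

/-- **`Π_{V∖L}·W_L ≤ GF(meets L)` coefficientwise**: `(C, {u}) ↦ C ∪ {u}` is injective on `2^{V∖L} × singles L` and lands in `meets L`
with the same profile. [this work] -/
theorem coeff_compl_mul_singles_le (L : Finset α) (n : α →₀ ℕ) :
    (gf ((univ \ L).powerset) * gf (singles L)).coeff n ≤ (gf (meets L)).coeff n := by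
  rw [coeff_gf_mul_gf, coeff_gf]
  refine Nat.cast_le.2 (card_le_card_of_injOn (fun CS => CS.1 ∪ CS.2) (fun CS hCS => ?_) (fun CS hCS CS' hCS' heq => ?_))
  · obtain ⟨hmem, hsum⟩ := mem_filter.1 (Finset.mem_coe.1 hCS)
    obtain ⟨hC, hS⟩ := mem_product.1 hmem
    obtain ⟨u, huL, hSu⟩ := mem_singles.1 hS
    have hCsub := mem_powerset.1 hC
    have huC : u ∉ CS.1 := fun huC => (mem_sdiff.1 (hCsub huC)).2 huL
    rw [Finset.mem_coe, mem_filter]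
    dsimp only
    refine ⟨mem_filter.2 ⟨mem_powerset.2 (subset_univ _), ⟨u, mem_inter.2 ⟨?_, huL⟩⟩⟩, ?_⟩
    · rw [hSu]; exact mem_union_right _ (mem_singleton_self u)
    · rw [← hsum, hSu, union_comm, ← insert_eq, ind_insert huC, add_comm]
      congr 1; unfold ind; rw [sum_singleton]
  · obtain ⟨hmem, _⟩ := mem_filter.1 (Finset.mem_coe.1 hCS)
    obtain ⟨hC, hS⟩ := mem_product.1 hmem
    obtain ⟨u, huL, hSu⟩ := mem_singles.1 hS
    obtain ⟨hmem', _⟩ := mem_filter.1 (Finset.mem_coe.1 hCS')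
    obtain ⟨hC', hS'⟩ := mem_product.1 hmem'
    obtain ⟨u', huL', hSu'⟩ := mem_singles.1 hS'
    have hCsub := mem_powerset.1 hC
    have hCsub' := mem_powerset.1 hC'
    have e : CS.1 ∪ CS.2 = CS'.1 ∪ CS'.2 := heq
    -- the unique element of `L` on both sides
    have huu : u = u' := by
      have hu : u ∈ CS'.1 ∪ CS'.2 := by rw [← e, hSu]; exact mem_union_right _ (mem_singleton_self u)
      rcases mem_union.1 hu with h | h
      · exact absurd huL (mem_sdiff.1 (hCsub' h)).2
      · rw [hSu'] at h; exact mem_singleton.1 h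
    subst huu
    have hS_eq : CS.2 = CS'.2 := by rw [hSu, hSu']
    have huC : u ∉ CS.1 := fun huC => (mem_sdiff.1 (hCsub huC)).2 huL
    have huC' : u ∉ CS'.1 := fun huC => (mem_sdiff.1 (hCsub' huC)).2 huL
    have hC_eq : CS.1 = CS'.1 := by
      ext x; constructor
      · intro hx
        have hx' : x ∈ CS'.1 ∪ CS'.2 := by rw [← e]; exact mem_union_left _ hx
        rcases mem_union.1 hx' with h | h
        · exact h
        · rw [hSu', mem_singleton] at h; subst h; exact absurd hx huC
      · intro hx
        have hx' : x ∈ CS.1 ∪ CS.2 := by rw [e]; exact mem_union_left _ hx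
        rcases mem_union.1 hx' with h | h
        · exact h
        · rw [hSu, mem_singleton] at h; subst h; exact absurd hx huC'
    exact Prod.ext hC_eq hS_eq

/-! ### The theorem -/

/-- **`R' = Θ₁·(Π·Y₂ − X·Z) + Π·X₁·Z₁ ∈ ℕ[s]` for every pair of up-sets** (`Y₂` = common members of size ≥ 2, `X₁, Z₁` = members of size ≤ 1).
With g23's split `M₂ = Π·T + e₂·R'` this reduces the whole co-level-2 row — loops and small sets included — to `T = L₂(all-live parts) ≥ 0`. [this work] -/
theorem coeff_Rprime_nonneg {𝒳 𝒵 : Finset (Finset α)} (h𝒳 : IsUpperSet (𝒳 : Set (Finset α)))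
    (h𝒵 : IsUpperSet (𝒵 : Set (Finset α))) (n : α →₀ ℕ) :
    0 ≤ (Th1 * (PiP * gf ((𝒳 ∩ 𝒵).filter fun S => 2 ≤ #S) - gf 𝒳 * gf 𝒵)
      + PiP * gf (𝒳.filter fun S => #S ≤ 1) * gf (𝒵.filter fun S => #S ≤ 1)).coeff n := by
  have hsubU : ∀ 𝒲 : Finset (Finset α), 𝒲 ⊆ univ.powerset := fun 𝒲 S _ => mem_powerset.2 (subset_univ _)
  have hTh1_bySize : ((univ.powerset : Finset (Finset α)).filter fun S => #S ≤ 1) = bySize (· ≤ 1) := rfl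
  -- degenerate cases: a family containing `∅` is everything, and `R' = 0`
  by_cases hX0 : ∅ ∈ 𝒳
  · have hX := eq_univ_powerset_of_empty_mem h𝒳 hX0
    subst hX
    rw [inter_eq_right.2 (hsubU 𝒵), hTh1_bySize, gf_filter_two_le_eq]
    have : (Th1 * (PiP * (gf 𝒵 - gf (𝒵.filter fun S => #S ≤ 1)) - gf univ.powerset * gf 𝒵)
        + PiP * gf (bySize (· ≤ 1)) * gf (𝒵.filter fun S => #S ≤ 1) : MvPolynomial α ℤ) = 0 := by
      unfold PiP Th1; ring
    rw [this, coeff_zero]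
  by_cases hZ0 : ∅ ∈ 𝒵
  · have hZ := eq_univ_powerset_of_empty_mem h𝒵 hZ0
    subst hZ
    rw [inter_eq_left.2 (hsubU 𝒳), hTh1_bySize, gf_filter_two_le_eq]
    have : (Th1 * (PiP * (gf 𝒳 - gf (𝒳.filter fun S => #S ≤ 1)) - gf 𝒳 * gf univ.powerset)
        + PiP * gf (𝒳.filter fun S => #S ≤ 1) * gf (bySize (· ≤ 1)) : MvPolynomial α ℤ) = 0 := by
      unfold PiP Th1; ring
    rw [this, coeff_zero]
  -- main case: loops
  set L := loops 𝒳 𝒵 with hLdef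
  obtain ⟨LX, hLX⟩ : ∃ A : Finset α, A = univ.filter fun u => ({u} : Finset α) ∈ 𝒳 := ⟨_, rfl⟩
  obtain ⟨LZ, hLZ⟩ : ∃ A : Finset α, A = univ.filter fun u => ({u} : Finset α) ∈ 𝒵 := ⟨_, rfl⟩
  have hL : L = LX ∩ LZ := by
    rw [hLdef, hLX, hLZ]; unfold loops; ext u; simp only [mem_filter, mem_univ, true_and, mem_inter]
  obtain ⟨X', hX'⟩ : ∃ A : Finset α, A = LX \ LZ := ⟨_, rfl⟩
  obtain ⟨Z', hZ'⟩ : ∃ A : Finset α, A = LZ \ LX := ⟨_, rfl⟩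
  obtain ⟨N, hN⟩ : ∃ A : Finset α, A = univ \ (LX ∪ LZ) := ⟨_, rfl⟩
  -- set identities and disjointness
  have dLX : Disjoint L X' := by rw [hL, hX']; exact disjoint_left.2 fun u h1 h2 => (mem_sdiff.1 h2).2 (mem_inter.1 h1).2
  have dLZ : Disjoint L Z' := by rw [hL, hZ']; exact disjoint_left.2 fun u h1 h2 => (mem_sdiff.1 h2).2 (mem_inter.1 h1).1
  have uLX : L ∪ X' = LX := by
    rw [hL, hX']; ext u; simp only [mem_union, mem_inter, mem_sdiff]; tauto
  have uLZ : L ∪ Z' = LZ := by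
    rw [hL, hZ']; ext u; simp only [mem_union, mem_inter, mem_sdiff]; tauto
  have dZN : Disjoint Z' N := by
    rw [hZ', hN]; exact disjoint_left.2 fun u h1 h2 => (mem_sdiff.1 h2).2 (mem_union_right _ (mem_sdiff.1 h1).1)
  have uZN : Z' ∪ N = univ \ LX := by
    rw [hZ', hN]; ext u; simp only [mem_union, mem_sdiff, mem_univ, true_and]; tauto
  have dLXc : Disjoint LX (univ \ LX) := disjoint_sdiff
  have uLXc : LX ∪ (univ \ LX) = univ := union_sdiff_of_subset (subset_univ _)
  have ee1_eq : (ee 1 : MvPolynomial α ℤ) = gf (singles L) + gf (singles X') + (gf (singles Z') + gf (singles N)) := by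
    rw [ee_one_eq_gf_singles_univ, ← uLXc, gf_singles_union dLXc, ← uZN, gf_singles_union dZN, ← uLX, gf_singles_union dLX]
  -- the small members
  have hLXmem : ∀ u, u ∈ LX ↔ ({u} : Finset α) ∈ 𝒳 := fun u => by rw [hLX]; simp
  have hLZmem : ∀ u, u ∈ LZ ↔ ({u} : Finset α) ∈ 𝒵 := fun u => by rw [hLZ]; simp
  have eX1 : gf (𝒳.filter fun S => #S ≤ 1) = gf (singles L) + gf (singles X') := by
    rw [filter_card_le_one_eq_singles hX0, ← hLX, ← uLX, gf_singles_union dLX]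
  have eZ1 : gf (𝒵.filter fun S => #S ≤ 1) = gf (singles L) + gf (singles Z') := by
    rw [filter_card_le_one_eq_singles hZ0, ← hLZ, ← uLZ, gf_singles_union dLZ]
  have hY0 : ∅ ∉ 𝒳 ∩ 𝒵 := fun h => hX0 (mem_inter.1 h).1
  have eY1 : ((𝒳 ∩ 𝒵).filter fun S => #S ≤ 1) = singles L := by
    rw [filter_card_le_one_eq_singles hY0, hLdef]; unfold loops
    congr 1; ext u; simp only [mem_filter, mem_univ, true_and, mem_inter]
  have eY2 : gf ((𝒳 ∩ 𝒵).filter fun S => 2 ≤ #S) = gf (𝒳 ∩ 𝒵) - gf (singles L) := by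
    rw [gf_filter_two_le_eq, eY1]
  -- the loop identity ingredients (as in `…SahiCTCCoLevelOne`)
  have hLinX : ∀ u ∈ L, ({u} : Finset α) ∈ 𝒳 := fun u hu => singleton_mem_left_of_mem_loops hu
  have hLinZ : ∀ u ∈ L, ({u} : Finset α) ∈ 𝒵 := fun u hu => singleton_mem_right_of_mem_loops hu
  have hY : IsUpperSet ((𝒳 ∩ 𝒵 : Finset (Finset α)) : Set (Finset α)) := by rw [coe_inter]; exact h𝒳.inter h𝒵
  have hLinY : ∀ u ∈ L, ({u} : Finset α) ∈ 𝒳 ∩ 𝒵 := fun u hu => mem_inter.2 ⟨hLinX u hu, hLinZ u hu⟩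
  have eX := gf_eq_meets_add_avoid h𝒳 hLinX
  have eZ := gf_eq_meets_add_avoid h𝒵 hLinZ
  have eY := gf_eq_meets_add_avoid hY hLinY
  rw [avoid_inter] at eY
  have ePi := PiP_eq_meets_add (α := α) L
  have eC := gf_powerset_compl_eq L 𝒳 𝒵
  set N₀ := ((univ \ L).powerset).filter fun S => S ∉ 𝒳 ∧ S ∉ 𝒵 with hN₀
  -- `∅` and the singletons of `N` lie in `N₀`
  obtain ⟨B, hB⟩ : ∃ B : Finset (Finset α), B = singles N ∪ {∅} := ⟨_, rfl⟩
  have hBsub : B ⊆ N₀ := by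
    rw [hB]; intro S hS
    rcases mem_union.1 hS with hS | hS
    · obtain ⟨w, hw, rfl⟩ := mem_singles.1 hS
      rw [hN] at hw
      have hw' := (mem_sdiff.1 hw).2
      have hwX : ({w} : Finset α) ∉ 𝒳 := fun h => hw' (mem_union_left _ ((hLXmem w).2 h))
      have hwZ : ({w} : Finset α) ∉ 𝒵 := fun h => hw' (mem_union_right _ ((hLZmem w).2 h))
      have hwL : w ∉ L := fun h => hwX (hLinX w h)
      refine mem_filter.2 ⟨mem_powerset.2 ?_, hwX, hwZ⟩
      intro x hx; rw [mem_singleton] at hx; subst hx; exact mem_sdiff.2 ⟨mem_univ _, hwL⟩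
    · rw [mem_singleton] at hS; subst hS
      exact mem_filter.2 ⟨mem_powerset.2 (empty_subset _), hX0, hZ0⟩
  have eB : gf B = gf (singles N) + 1 := by
    rw [hB, gf_union, gf_singleton_empty]
    exact disjoint_singleton_right.2 fun h => by
      obtain ⟨w, _, hw⟩ := mem_singles.1 h
      exact singleton_ne_empty w hw.symm
  have eN : gf N₀ = gf (N₀ \ B) + gf (singles N) + 1 := by
    rw [add_assoc, ← eB, ← gf_union sdiff_disjoint, sdiff_union_of_subset hBsub]
  -- the decomposition
  have key : Th1 * (PiP * gf ((𝒳 ∩ 𝒵).filter fun S => 2 ≤ #S) - gf 𝒳 * gf 𝒵)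
      + PiP * gf (𝒳.filter fun S => #S ≤ 1) * gf (𝒵.filter fun S => #S ≤ 1) =
      Th1 * (gf ((univ \ L).powerset) * gf (avoid L 𝒳 ∩ avoid L 𝒵) - gf (avoid L 𝒳) * gf (avoid L 𝒵))
      + Th1 * gf (meets L) * gf (N₀ \ B)
      + (1 + gf (singles N)) * ((gf (meets L) - gf ((univ \ L).powerset) * gf (singles L))
          + (gf (singles X') + gf (singles Z') + gf (singles N)) * gf (meets L))
      + PiP * gf (singles X') * gf (singles Z') := by
    have eTh : (Th1 : MvPolynomial α ℤ) = 1 + ee 1 := by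
      unfold Th1 ee bySize
      rw [← gf_singleton_empty, ← gf_union]
      · congr 1; ext S
        simp only [mem_filter, mem_powerset, subset_univ, true_and, mem_union, mem_singleton]
        constructor
        · intro h
          rcases Nat.lt_or_ge #S 1 with h1 | h1
          · exact Or.inl (card_eq_zero.1 (by omega))
          · exact Or.inr (le_antisymm h h1)
        · rintro (rfl | h)
          · simp
          · omega
      · exact disjoint_left.2 fun S h1 h2 => by
          rw [mem_singleton] at h1; subst h1
          have := (mem_filter.1 h2).2; simp at this
    rw [eY2, eX1, eZ1, eTh, ee1_eq, eY, eX, eZ, ePi, eC, eN]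
    ring
  rw [key]
  -- nonnegativity
  have nTh : ∀ m, 0 ≤ (Th1 : MvPolynomial α ℤ).coeff m := fun m => by unfold Th1; exact coeff_gf_nonneg _ m
  have nPi : ∀ m, 0 ≤ (PiP : MvPolynomial α ℤ).coeff m := fun m => by unfold PiP; exact coeff_gf_nonneg _ m
  have nadd : ∀ {P Q : MvPolynomial α ℤ}, (∀ m, 0 ≤ P.coeff m) → (∀ m, 0 ≤ Q.coeff m) → ∀ m, 0 ≤ (P + Q).coeff m :=
    fun hP hQ m => by rw [coeff_add]; exact add_nonneg (hP m) (hQ m)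
  have n1 : ∀ m, 0 ≤ (1 : MvPolynomial α ℤ).coeff m := fun m => by
    rw [← gf_singleton_empty]; exact coeff_gf_nonneg _ m
  have hsubX : ∀ T ∈ avoid L 𝒳, T ⊆ univ \ L := fun T hT => (mem_filter.1 hT).2
  have hsubZ : ∀ T ∈ avoid L 𝒵, T ⊆ univ \ L := fun T hT => (mem_filter.1 hT).2
  have hupX : ∀ A ∈ avoid L 𝒳, ∀ B : Finset α, A ⊆ B → B ⊆ univ \ L → B ∈ avoid L 𝒳 :=
    fun A hA B hAB hB => mem_filter.2 ⟨h𝒳 hAB (mem_filter.1 hA).1, hB⟩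
  have hupZ : ∀ A ∈ avoid L 𝒵, ∀ B : Finset α, A ⊆ B → B ⊆ univ \ L → B ∈ avoid L 𝒵 :=
    fun A hA B hAB hB => mem_filter.2 ⟨h𝒵 hAB (mem_filter.1 hA).1, hB⟩
  have nBr := coeff_harris_upIn_sub_nonneg hsubX hsubZ hupX hupZ
  have nM : ∀ m, 0 ≤ (gf (meets L) - gf ((univ \ L).powerset) * gf (singles L)).coeff m := fun m => by
    rw [coeff_sub, sub_nonneg]; exact coeff_compl_mul_singles_le L m
  refine nadd (nadd (nadd (coeff_mul_nonneg nTh nBr) ?_) ?_) ?_ n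
  · exact coeff_mul_nonneg (coeff_mul_nonneg nTh (coeff_gf_nonneg _)) (coeff_gf_nonneg _)
  · refine coeff_mul_nonneg (nadd n1 (coeff_gf_nonneg _)) (nadd nM ?_)
    exact coeff_mul_nonneg (nadd (nadd (coeff_gf_nonneg _) (coeff_gf_nonneg _)) (coeff_gf_nonneg _)) (coeff_gf_nonneg _)
  · exact coeff_mul_nonneg (coeff_mul_nonneg nPi (coeff_gf_nonneg _)) (coeff_gf_nonneg _)

end Summit.CriticalPhenomena.PercolationContinuityZ3.Theorems.SahiCTCForms
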